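import Summits.ResolutionOfSingularities.ResolutionOfSingularities.Theorems.WeightedInvariantIota3RatioLetterExact
import Summits.ResolutionOfSingularities.ResolutionOfSingularities.Theorems.WeightedInvariantIota3FibreDescentGenericPoint
import Summits.ResolutionOfSingularities.ResolutionOfSingularities.Theorems.WeightedInvariantIota3FibreDescentGenericPointClass
import HarnessLib

/-!
# (IDLexact)₃ FROM INVARIANCE OF THE LEVELS AT ONE RING: the gap list of `stub_keyRungGrHomLE_three` with (IDLexact)₃ replaced by
# (INV)₃ + (RAD)₃ (door `HypersurfaceCentreConstruction`, stmt-ResolutionOfSingularities-19897)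

Helper for `stub_keyRungGrHomLE_three` (def-free, `--supports 19897`).  Sequel of the descent engine (…Iota3FibreDescentEngine p822040, its
localised form …Iota3FibreDescentGenericPoint p822119, class membership …Iota3FibreDescentGenericPointClass).  [OURS · L1 W4.3 · audit glue;
AI work, weaker than expert review; nothing here is a statement of the manuscript under review.]

THE REDUCTION (`idealDescentExact3_of_invariance`).  Hypothesis (IDLexact)₃ of the gap list of record `keyRungGrHomLE_three_of_idealDescentExact4`
(p820504) — «along an `𝔪`-preserving local formally smooth e.f.t. `φ : T → T'` of regular local rings of dimension three the two levels
`F'(r₁), F'(r₂)` of every two-flag of `T'` carrying `φ g` to an exactly ratio-maximal admissible `(q; r₁, r₂)` with `q < r₂` are extended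
from `T`» — FOLLOWS from two statements about ONE ring / ONE map:
* **(INV)₃** «in a regular local ring `A` of dimension three, two two-flags carrying `g ∈ 𝔪 ∖ 0` to level `r₁ν` of the same admissible
  `(q; r₁, r₂)`, `q < r₂`, exactly ratio-maximal for `g`, have comparable (hence equal) levels `r₁` and `r₂`» — the INVARIANCE content of the
  dominance word (…Iota3DominanceWordResidue*, DOM-RATIO-ONE.md; OUTRIGHT off the power positions);
* **(RAD)₃** «for `φ` as above the fibre ideal `𝔪·(T' ⊗_T T')` is radical» — geometric reducedness of the (separable, since formally smooth)
  residue extension `κ(T) → κ(T')`; standard, not in the tree.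
PROOF.  The levels are `𝔪'`-primary; by `FibreDescent.flagLevel_extended_of_generic_invariance` it suffices to compare, at each generic point
`C_𝔓` of the fibre of `C = T' ⊗_T T'`, the levels of the two image flags under `q₁, q₂ : T' ⇉ C_𝔓`.  `C_𝔓` is regular local of dimension
three (`FibreDescent.isRegularLocalRing_atPrime`, `ringKrullDim_atPrime_eq`), `q₁` is in the class (flat, local, `𝔪`-preserving, formally
smooth, e.f.t.) and `q₂` is flat and `𝔪`-preserving; so both image flags are two-flags reaching `(q; r₁, r₂)` for the common image of `g`
(ascent, …Iota3SigmaAscent), exact ratio-maximality moves up to `C_𝔓` by ONE-MEMBER DESCENT along `q₁` (`JFlatEssSmooth.oneFlagReaches_of_algebraMap`,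
as in `ratio_le_of_flagReaches_algebraMap`), and (INV)₃ at `C_𝔓` compares the levels.
GAP LIST `keyRungGrHomLE_three_of_invariance5`: hypotheses hD (desc-τ, typing item), (INV)₃, (RAD)₃, hgame, hres — (IDLexact)₃ is gone.
-/

noncomputable section

open IsLocalRing Literature.AlgebraicGeometry.Resolution TensorProduct Algebra.TensorProduct
open Summit.ResolutionOfSingularities.ResolutionOfSingularities.Theorems
open Summit.ResolutionOfSingularities.ResolutionOfSingularities.Cruxes.HypersurfaceCentreConstruction.LocalEngine.Iota3.RatContact

set_option linter.dupNamespace false -- mandated namespace of this single-conjunct summit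

namespace Summit.ResolutionOfSingularities.ResolutionOfSingularities.Cruxes.HypersurfaceCentreConstruction.LocalEngine

namespace FibreDescent

open Iota3

/-- The right coprojection followed by localisation, `q₂ : T' → T' ⊗_T T' → C_𝔓`, is flat (flip of the flat left structure, then a
localisation). [cite: StacksProject, Tag 00ON] -/
theorem flat_toAtPrime_right {T T' : Type} [CommRing T] [CommRing T'] [Algebra T T'] [Module.Flat T T']
    (𝔓 : Ideal (T' ⊗[T] T')) [𝔓.IsPrime] :
    ((algebraMap (T' ⊗[T] T') (Localization.AtPrime 𝔓)).comp
      ((includeRight : T' →ₐ[T] T' ⊗[T] T') : T' →+* T' ⊗[T] T')).Flat := by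
  have h1 : ((includeRight : T' →ₐ[T] T' ⊗[T] T') : T' →+* T' ⊗[T] T') =
      ((Algebra.TensorProduct.comm T T' T').toAlgHom.toRingHom).comp (algebraMap T' (T' ⊗[T] T')) := by
    ext x
    change (1 : T') ⊗ₜ[T] x = Algebra.TensorProduct.comm T T' T' (algebraMap T' (T' ⊗[T] T') x)
    rw [Algebra.TensorProduct.algebraMap_apply, Algebra.algebraMap_self, RingHom.id_apply, Algebra.TensorProduct.comm_tmul]
  rw [h1]
  refine RingHom.Flat.comp (RingHom.Flat.comp ?_ ?_) ?_
  · exact RingHom.flat_algebraMap_iff.mpr inferInstance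
  · exact RingHom.Flat.of_bijective (Algebra.TensorProduct.comm T T' T').bijective
  · exact RingHom.flat_algebraMap_iff.mpr (IsLocalization.flat _ 𝔓.primeCompl)

/-- **(IDLexact)₃ ⟸ (INV)₃ + (RAD)₃** — see the module docstring. [OURS · L1 W4.3 · audit glue] -/
theorem idealDescentExact3_of_invariance
    (hINV : ∀ (A : Type) [CommRing A] [IsRegularLocalRing A] (g : A), ringKrullDim A = (3 : ℕ) → g ≠ 0 → g ∈ maximalIdeal A →
      ∀ (g₁ g₂ g₁' g₂' : A) (q r₁ r₂ : ℕ), IsTwoFlag g₁ g₂ → IsTwoFlag g₁' g₂' → AdmissibleTriple q r₁ r₂ → q < r₂ →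
      g ∈ flagContactFiltration g₁ g₂ q r₁ r₂ (r₁ * (adicOrder g).toNat) →
      g ∈ flagContactFiltration g₁' g₂' q r₁ r₂ (r₁ * (adicOrder g).toNat) →
      (∀ q' r₁' r₂' : ℕ, AdmissibleTriple q' r₁' r₂' → FlagReaches g (adicOrder g).toNat q' r₁' r₂' → r₁' * r₂ ≤ r₁ * r₂') →
      flagContactFiltration g₁' g₂' q r₁ r₂ r₁ ≤ flagContactFiltration g₁ g₂ q r₁ r₂ r₁ ∧
        flagContactFiltration g₁' g₂' q r₁ r₂ r₂ ≤ flagContactFiltration g₁ g₂ q r₁ r₂ r₂)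
    (hRAD : ∀ (T T' : Type) [CommRing T] [IsRegularLocalRing T] [CommRing T'] [IsRegularLocalRing T'] [Algebra T T']
      [IsLocalHom (algebraMap T T')] [Algebra.FormallySmooth T T'] [Algebra.EssFiniteType T T'],
      ringKrullDim T = (3 : ℕ) → ringKrullDim T' = (3 : ℕ) → (maximalIdeal T).map (algebraMap T T') = maximalIdeal T' →
      ((maximalIdeal T').map (algebraMap T' (T' ⊗[T] T'))).IsRadical)
    (T T' : Type) [CommRing T] [IsRegularLocalRing T] [CommRing T'] [IsRegularLocalRing T'] [Algebra T T']
    [IsLocalHom (algebraMap T T')] [Algebra.FormallySmooth T T'] [Algebra.EssFiniteType T T'] (g : T)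
    (hdim : ringKrullDim T = (3 : ℕ)) (hdim' : ringKrullDim T' = (3 : ℕ))
    (hm : (maximalIdeal T).map (algebraMap T T') = maximalIdeal T') (hg0 : g ≠ 0) (hg : g ∈ maximalIdeal T)
    (g₁' g₂' : T') (q r₁ r₂ : ℕ) (hfl : IsTwoFlag g₁' g₂') (hadm : AdmissibleTriple q r₁ r₂) (hq : q < r₂)
    (hreach : algebraMap T T' g ∈ flagContactFiltration g₁' g₂' q r₁ r₂ (r₁ * (adicOrder g).toNat))
    (hexact : ∀ q' r₁' r₂' : ℕ, AdmissibleTriple q' r₁' r₂' →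
      FlagReaches (algebraMap T T' g) (adicOrder g).toNat q' r₁' r₂' → r₁' * r₂ ≤ r₁ * r₂') :
    ∃ J₁ J₂ : Ideal T, J₁.map (algebraMap T T') = flagContactFiltration g₁' g₂' q r₁ r₂ r₁ ∧
      J₂.map (algebraMap T T') = flagContactFiltration g₁' g₂' q r₁ r₂ r₂ := by
  haveI : Module.Flat T T' := IotaOrderEssSmooth.flat_of_formallySmooth_of_essFiniteType T T'
  haveI : IsNoetherianRing (T' ⊗[T] T') := isNoetherianRing_tensor
  have hrad := hRAD T T' hdim hdim' hm
  have hfin := finite_minimalPrimes_fibre (T := T) (T' := T')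
  -- the data upstairs
  set f := algebraMap T T' g with hfdef
  have hf0 : f ≠ 0 := fun h => hg0 ((mem_iff_algebraMap_mem_map_of_flat hm ⊥ g).mpr (by rw [Ideal.map_bot]; exact h))
  have hf : f ∈ maximalIdeal T' := hm.le (Ideal.mem_map_of_mem _ hg)
  have hνf : adicOrder f = adicOrder g := adicOrder_algebraMap_eq_of_flat hm g
  -- the invariance at each generic point of the fibre, for both levels at once
  have key : ∀ (𝔓 : Ideal (T' ⊗[T] T')) [𝔓.IsPrime],
      𝔓 ∈ ((maximalIdeal T').map (algebraMap T' (T' ⊗[T] T'))).minimalPrimes →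
      ∀ n : ℕ, (n = r₁ ∨ n = r₂) →
      flagContactFiltration
          (algebraMap (T' ⊗[T] T') (Localization.AtPrime 𝔓) ((1 : T') ⊗ₜ[T] g₁'))
          (algebraMap (T' ⊗[T] T') (Localization.AtPrime 𝔓) ((1 : T') ⊗ₜ[T] g₂')) q r₁ r₂ n ≤
        flagContactFiltration
          (algebraMap (T' ⊗[T] T') (Localization.AtPrime 𝔓) (g₁' ⊗ₜ[T] (1 : T')))
          (algebraMap (T' ⊗[T] T') (Localization.AtPrime 𝔓) (g₂' ⊗ₜ[T] (1 : T'))) q r₁ r₂ n := by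
    intro 𝔓 _ h𝔓 n hn
    -- the generic point `L = C_𝔓` and its two structure maps
    haveI hregL : IsRegularLocalRing (Localization.AtPrime 𝔓) := isRegularLocalRing_atPrime 𝔓 hrad h𝔓 inferInstance
    have hdimL : ringKrullDim (Localization.AtPrime 𝔓) = (3 : ℕ) := by rw [ringKrullDim_atPrime_eq 𝔓 hrad h𝔓, hdim']
    haveI : IsLocalHom (algebraMap T' (Localization.AtPrime 𝔓)) := isLocalHom_atPrime 𝔓 hrad h𝔓
    haveI : Module.Flat T' (Localization.AtPrime 𝔓) := flat_atPrime (T := T) 𝔓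
    haveI : Algebra.FormallySmooth T' (Localization.AtPrime 𝔓) := formallySmooth_atPrime (T := T) 𝔓
    haveI : Algebra.EssFiniteType T' (Localization.AtPrime 𝔓) := essFiniteType_atPrime (T := T) 𝔓
    have hm₁ : (maximalIdeal T').map (algebraMap T' (Localization.AtPrime 𝔓)) = maximalIdeal (Localization.AtPrime 𝔓) :=
      map_maximalIdeal_atPrime_eq 𝔓 hrad h𝔓
    set q₂ : T' →+* Localization.AtPrime 𝔓 := (algebraMap (T' ⊗[T] T') (Localization.AtPrime 𝔓)).comp
      ((includeRight : T' →ₐ[T] T' ⊗[T] T') : T' →+* T' ⊗[T] T') with hq₂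
    have hm₂ : (maximalIdeal T').map q₂ = maximalIdeal (Localization.AtPrime 𝔓) := map_maximalIdeal_toAtPrime_right hm hrad 𝔓 h𝔓
    -- the common image of `g`
    set G := algebraMap T' (Localization.AtPrime 𝔓) f with hGdef
    have hq₁f : algebraMap T' (Localization.AtPrime 𝔓) f =
        algebraMap (T' ⊗[T] T') (Localization.AtPrime 𝔓) (algebraMap T' (T' ⊗[T] T') f) :=
      IsScalarTower.algebraMap_apply T' (T' ⊗[T] T') (Localization.AtPrime 𝔓) f
    have hq₂f : q₂ f = G := by
      rw [hGdef, hq₁f, hq₂, RingHom.comp_apply, hfdef]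
      congr 1
      change (includeRight : T' →ₐ[T] T' ⊗[T] T') (algebraMap T T' g) = algebraMap T' (T' ⊗[T] T') (algebraMap T T' g)
      rw [(includeRight : T' →ₐ[T] T' ⊗[T] T').commutes, ← IsScalarTower.algebraMap_apply]
    have hG0 : G ≠ 0 := fun h => hf0 ((mem_iff_algebraMap_mem_map_of_flat hm₁ ⊥ f).mpr (by rw [Ideal.map_bot]; exact h))
    have hGm : G ∈ maximalIdeal (Localization.AtPrime 𝔓) := hm₁.le (Ideal.mem_map_of_mem _ hf)
    have hνG : adicOrder G = adicOrder g := by rw [hGdef, adicOrder_algebraMap_eq_of_flat hm₁ f, hνf]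
    -- the two image flags
    have hflA : IsTwoFlag (algebraMap T' (Localization.AtPrime 𝔓) g₁') (algebraMap T' (Localization.AtPrime 𝔓) g₂') :=
      IsTwoFlag.algebraMap_of_flat hm₁ hfl
    have hflat₂ : q₂.Flat := flat_toAtPrime_right (T := T) 𝔓
    have hflB : IsTwoFlag (q₂ g₁') (q₂ g₂') :=
      @IsTwoFlag.algebraMap_of_flat T' (Localization.AtPrime 𝔓) _ _ _ _ q₂.toAlgebra hflat₂ hm₂ g₁' g₂' hfl
    have hreachA : G ∈ flagContactFiltration (algebraMap T' (Localization.AtPrime 𝔓) g₁')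
        (algebraMap T' (Localization.AtPrime 𝔓) g₂') q r₁ r₂ (r₁ * (adicOrder G).toNat) := by
      rw [hνG]
      exact map_mem_flagContactFiltration (algebraMap T' (Localization.AtPrime 𝔓)) hm₁.le hreach
    have hreachB : G ∈ flagContactFiltration (q₂ g₁') (q₂ g₂') q r₁ r₂ (r₁ * (adicOrder G).toNat) := by
      rw [hνG, ← hq₂f]
      exact map_mem_flagContactFiltration q₂ hm₂.le hreach
    -- exact ratio-maximality moves up to `C_𝔓` by one-member descent along `q₁`
    have hexactL : ∀ q' r₁' r₂' : ℕ, AdmissibleTriple q' r₁' r₂' →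
        FlagReaches G (adicOrder G).toNat q' r₁' r₂' → r₁' * r₂ ≤ r₁ * r₂' := by
      intro q' r₁' r₂' hadm' hreach'
      have hr₂' : 0 < r₂' := hadm'.pos.2.1
      rw [hνG, ← hνf] at hreach'
      have hdown : FlagReaches f (adicOrder f).toNat r₂' r₁' r₂' :=
        JFlatEssSmooth.flagReaches_of_oneFlagReaches hdim'
          (JFlatEssSmooth.oneFlagReaches_of_algebraMap hm₁ hdim' hdimL hf0 hf hr₂' r₁'
            (FlagReaches.oneFlagReaches hadm' hreach'))
      rw [hνf] at hdown
      exact hexact r₂' r₁' r₂' ⟨hr₂', le_rfl, hadm'.2.2⟩ hdown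
    -- (INV)₃ at `C_𝔓`
    have hinv := hINV (Localization.AtPrime 𝔓) G hdimL hG0 hGm _ _ _ _ q r₁ r₂ hflA hflB hadm hq hreachA hreachB hexactL
    -- unfold the images: `algebraMap T' C_𝔓 x = (x ⊗ 1)/1`, `q₂ x = (1 ⊗ x)/1`
    have e₁ : ∀ x : T', algebraMap T' (Localization.AtPrime 𝔓) x =
        algebraMap (T' ⊗[T] T') (Localization.AtPrime 𝔓) (x ⊗ₜ[T] (1 : T')) := fun x => by
      rw [IsScalarTower.algebraMap_apply T' (T' ⊗[T] T') (Localization.AtPrime 𝔓) x, Algebra.TensorProduct.algebraMap_apply,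
        Algebra.algebraMap_self, RingHom.id_apply]
    have e₂ : ∀ x : T', q₂ x = algebraMap (T' ⊗[T] T') (Localization.AtPrime 𝔓) ((1 : T') ⊗ₜ[T] x) := fun x => rfl
    rw [← e₁, ← e₁, ← e₂, ← e₂]
    rcases hn with rfl | rfl
    · exact hinv.1
    · exact hinv.2
  obtain ⟨J₁, hJ₁⟩ := flagLevel_extended_of_generic_invariance hm hrad hfin g₁' g₂' q r₁ r₂ r₁
    (fun 𝔓 _ h𝔓 => key 𝔓 h𝔓 r₁ (Or.inl rfl))
  obtain ⟨J₂, hJ₂⟩ := flagLevel_extended_of_generic_invariance hm hrad hfin g₁' g₂' q r₁ r₂ r₂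
    (fun 𝔓 _ h𝔓 => key 𝔓 h𝔓 r₂ (Or.inr rfl))
  exact ⟨J₁, J₂, hJ₁, hJ₂⟩

end FibreDescent

open Iota3 in
/-- **GAP LIST of `stub_keyRungGrHomLE_three` with (IDLexact)₃ REPLACED by (INV)₃ + (RAD)₃**: hypotheses hD (desc-τ as typed; door-proved
`Iota3.isTiePosition_descent_door`), (INV)₃ (invariance of the two levels of exactly ratio-maximal flags at ONE regular local ring of dimension
three — the content of the dominance word), (RAD)₃ (the fibre ideal `𝔪·(T' ⊗_T T')` of a class map is radical), hgame, hres (the residue of the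
dominance word at the power positions). [OURS · L1 W4.3 · audit glue] -/
theorem keyRungGrHomLE_three_of_invariance5 (p : ℕ)
    (hD : ∀ (T T' : Type) [CommRing T] [IsRegularLocalRing T] [CommRing T'] [IsRegularLocalRing T'] [Algebra T T']
      [IsLocalHom (algebraMap T T')] [Algebra.FormallySmooth T T'] [Algebra.EssFiniteType T T'] (g : T),
      ringKrullDim T' ≤ 3 → IsTiePosition T' (algebraMap T T' g) → IsTiePosition T g)
    (hINV : ∀ (A : Type) [CommRing A] [IsRegularLocalRing A] (g : A), ringKrullDim A = (3 : ℕ) → g ≠ 0 → g ∈ maximalIdeal A →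
      ∀ (g₁ g₂ g₁' g₂' : A) (q r₁ r₂ : ℕ), IsTwoFlag g₁ g₂ → IsTwoFlag g₁' g₂' → AdmissibleTriple q r₁ r₂ → q < r₂ →
      g ∈ flagContactFiltration g₁ g₂ q r₁ r₂ (r₁ * (adicOrder g).toNat) →
      g ∈ flagContactFiltration g₁' g₂' q r₁ r₂ (r₁ * (adicOrder g).toNat) →
      (∀ q' r₁' r₂' : ℕ, AdmissibleTriple q' r₁' r₂' → FlagReaches g (adicOrder g).toNat q' r₁' r₂' → r₁' * r₂ ≤ r₁ * r₂') →
      flagContactFiltration g₁' g₂' q r₁ r₂ r₁ ≤ flagContactFiltration g₁ g₂ q r₁ r₂ r₁ ∧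
        flagContactFiltration g₁' g₂' q r₁ r₂ r₂ ≤ flagContactFiltration g₁ g₂ q r₁ r₂ r₂)
    (hRAD : ∀ (T T' : Type) [CommRing T] [IsRegularLocalRing T] [CommRing T'] [IsRegularLocalRing T'] [Algebra T T']
      [IsLocalHom (algebraMap T T')] [Algebra.FormallySmooth T T'] [Algebra.EssFiniteType T T'],
      ringKrullDim T = (3 : ℕ) → ringKrullDim T' = (3 : ℕ) → (maximalIdeal T).map (algebraMap T T') = maximalIdeal T' →
      ((maximalIdeal T').map (algebraMap T' (T' ⊗[T] T'))).IsRadical)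
    (hgame : CanonicalGameClauseHomLE 3 p iotaFlatT jFlatT)
    (hres : ∀ (k₀ : Type) [Field k₀] [CharP k₀ p] [PerfectField k₀]
      (S : Type) [CommRing S] [Algebra k₀ S] [Algebra.EssFiniteType k₀ S] [IsRegularLocalRing S] (f : S),
      ringKrullDim S = (3 : ℕ) → f ≠ 0 → f ∈ (maximalIdeal S) ^ 2 →
      ContactCylinder.topStratumPrime iotaOrdEpsTau S f = maximalIdeal S → iotaEps S f ≠ 1 →
      (∃ ℓ ∈ maximalIdeal S, f ∈ Ideal.span {ℓ ^ (adicOrder f).toNat} ⊔ maximalIdeal S ^ ((adicOrder f).toNat + 1)) →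
      ∀ (a b : ℕ), 0 < b →
      (∀ q' r₁' r₂' : ℕ, AdmissibleTriple q' r₁' r₂' → FlagReaches f (adicOrder f).toNat q' r₁' r₂' → r₁' * b ≤ a * r₂') →
      ∀ (g₁ g₂ g₁' g₂' : S) (q r₁ r₂ : ℕ), AdmissibleTriple q r₁ r₂ → r₁ * b = a * r₂ → q < r₂ → r₂ < r₁ →
        IsTwoFlag g₁ g₂ → IsTwoFlag g₁' g₂' →
        f ∈ flagContactFiltration g₁ g₂ q r₁ r₂ (r₁ * (adicOrder f).toNat) →
        f ∈ flagContactFiltration g₁' g₂' q r₁ r₂ (r₁ * (adicOrder f).toNat) →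
        g₂' ∈ flagContactFiltration g₁ g₂ q r₁ r₂ r₂) :
    KeyRungGrHomLE 3 p :=
  keyRungGrHomLE_three_of_idealDescentExact4 p hD
    (fun T T' _ _ _ _ _ _ _ _ g hdim hdim' hm hg0 hg g₁' g₂' q r₁ r₂ hfl hadm hq hreach hexact =>
      FibreDescent.idealDescentExact3_of_invariance hINV hRAD T T' g hdim hdim' hm hg0 hg g₁' g₂' q r₁ r₂ hfl hadm hq hreach hexact)
    hgame hres

end Summit.ResolutionOfSingularities.ResolutionOfSingularities.Cruxes.HypersurfaceCentreConstruction.LocalEngine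

end
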